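import Summits.KontsevichZagierPeriods.KontsevichZagierPeriods.Theorems.HurwitzMicroSectorsNormalFormPrincipleDimOnePiece
import Summits.KontsevichZagierPeriods.KontsevichZagierPeriods.Theorems.AbelContractionRealHyperellipticSectorPortDimOneRatMultiple

/-!
# Route AbelContraction — `RealHyperellipticSector` (crux stmt-KontsevichZagierPeriods-12475):
# the dimension-certified port, layer 9 — a rational representation on a bounded interval with algebraic ends

Helper file of the line `Lines/birth.lean` (stub `stub_bakerAlg`, `--supports` the crux): the port
of `Theorems/HurwitzMicroSectorsNormalFormPrincipleDimOnePiece.lean` (namespace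
`…NormalFormPrinciple.PiBox.Dlog`) INTO THE BUDGET `KZ.relationsLE 1`: a representation of KZ's
rational shape (`IsRational`) on a bounded interval with REAL ALGEBRAIC end points is a mixed
normal form in `FormalRep ⧸ relationsLE 1` (`nfD_of_isRational_interval`, and
`nfD_of_isRational_interval_any` — registered sub-goal — for the possibly empty interval): reduced
form, ONE affine move of dimension `1` with algebraic coefficients to the unit slab
(`Port.Dlog.SiegeK3.affineA_sub_mem_relationsLE`), then `Port.Dlog.nfD_of_algK`.

The reduced form `exists_reduced_of_isRational_interval` and `image_affine_slab_of_pos`,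
`AlgSplitK5.exists_repK_unit` are reused from the originals.

Sources: M. Kontsevich, D. Zagier, *Periods* (2001), §1.2 rules (1), (2) [KontsevichZagier2001].
No definitions are introduced.
-/

noncomputable section

open MeasureTheory Set
open scoped Polynomial
open Literature.NumberTheory.Transcendental Literature.NumberTheory.Transcendental.KZ
open Literature.ModelTheory.ExponentialFields (IsSemialgebraic)

namespace Summit.KontsevichZagierPeriods.AbelContraction.RealHyperellipticSector.Port

namespace Dlog

open Summit.KontsevichZagierPeriods.HurwitzMicroSectors.NormalFormPrinciple.PiBox
  (AlgSplitK5.exists_repK_unit)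
open Summit.KontsevichZagierPeriods.HurwitzMicroSectors.NormalFormPrinciple.PiBox.Dlog
  (exists_reduced_of_isRational_interval image_affine_slab_of_pos)

variable {RA : ℝ → ℝ → ℝ → IntegralRep 1} {ZA : ℝ → IntegralRep 0} {RG : ℝ → ℝ → IntegralRep 1}

/-! ## A rational representation on a bounded interval with algebraic ends is a mixed normal form -/

/-- **A representation of KZ's rational shape on a bounded interval with real algebraic end points
`a < b` is a mixed normal form.** Reduced form (`exists_reduced_of_isRational_interval`), one affine
move `x = a + (b−a)t` with algebraic coefficients to the unit slab
(`SiegeK3.affineA_sub_mem_relationsLE`, rule 2 in dimension `1`),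
whose pull-back integrand `(b−a)P(a+(b−a)t)/Q(a+(b−a)t)` is `K`-rational (`K = ℚ̄ ∩ ℝ`) and pole-free on
`[0,1]`, then `nfD_of_algK`. (inside the budget `relationsLE 1`) [cite: KontsevichZagier2001, §1.2 rules (1), (2)] -/
theorem nfD_of_isRational_interval
    (hR : ∀ a b c, IsAlgebraic ℚ a → IsAlgebraic ℚ b → IsAlgebraic ℚ c → 0 < a →
      (RA a b c).domain = {x | x 0 ∈ Set.Ioo a b} ∧ (RA a b c).integrand = fun x => c / x 0)
    (hZ : ∀ r, IsAlgebraic ℚ r → (ZA r).domain = univ ∧ (ZA r).integrand = fun _ => r)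
    (hRG : ∀ t d, IsAlgebraic ℚ t → IsAlgebraic ℚ d →
      (RG t d).domain = {x | x 0 ∈ Set.Ioo 0 t} ∧ (RG t d).integrand = fun x => d / (1 + x 0 ^ 2))
    {a b : ℝ} (ha : IsAlgebraic ℚ a) (hb : IsAlgebraic ℚ b) (hab : a < b)
    (N : IntegralRep 1) (hNd : N.domain = {x | x 0 ∈ Set.Ioo a b}) (hN : N.IsRational) :
    ∃ (r : ℝ) (k : ℕ) (u c : Fin k → ℝ) (k' : ℕ) (t d : Fin k' → ℝ), IsAlgebraic ℚ r ∧ (∀ j, 1 < u j) ∧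
      (∀ j, IsAlgebraic ℚ (u j)) ∧ (∀ j, IsAlgebraic ℚ (c j)) ∧ (∀ l, 0 ≤ t l) ∧
      (∀ l, IsAlgebraic ℚ (t l)) ∧ (∀ l, IsAlgebraic ℚ (d l)) ∧
      QuotientAddGroup.mk' (relationsLE 1) (of N) = QuotientAddGroup.mk' (relationsLE 1) (of (ZA r)) +
        ∑ j, QuotientAddGroup.mk' (relationsLE 1) (of (RA 1 (u j) (c j))) +
        ∑ l, QuotientAddGroup.mk' (relationsLE 1) (of (RG (t l) (d l))) := by
  obtain ⟨P, Q, hQ0, hQab, hNi⟩ := exists_reduced_of_isRational_interval hab N hNd hN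
  set K := algebraicClosure ℚ ℝ
  have hs : 0 < b - a := sub_pos.mpr hab
  have hsA : IsAlgebraic ℚ (b - a) := hb.sub ha
  -- the algebraic data as elements of `K`
  set a' : K := ⟨a, mem_algebraicClosure_iff.mpr ha⟩ with ha'
  set s' : K := ⟨b - a, mem_algebraicClosure_iff.mpr hsA⟩ with hs'
  have ea : ((a' : K) : ℝ) = a := rfl
  have es : ((s' : K) : ℝ) = b - a := rfl
  -- the pulled-back integrand over `K`
  set Φp : K[X] := Polynomial.C a' + Polynomial.C s' * Polynomial.X with hΦp
  set Pt : K[X] := Polynomial.C s' * (P.map (algebraMap ℚ K)).comp Φp with hPt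
  set Qt : K[X] := (Q.map (algebraMap ℚ K)).comp Φp with hQt
  have hΦev : ∀ t : ℝ, (Polynomial.aeval t Φp : ℝ) = a + (b - a) * t := by
    intro t
    rw [hΦp, map_add, map_mul, Polynomial.aeval_C, Polynomial.aeval_C, Polynomial.aeval_X]
    rfl
  have hQtev : ∀ t : ℝ, (Polynomial.aeval t Qt : ℝ) = Polynomial.aeval (a + (b - a) * t) Q := by
    intro t
    rw [hQt, Polynomial.aeval_comp, hΦev, Polynomial.aeval_map_algebraMap]
  have hPtev : ∀ t : ℝ, (Polynomial.aeval t Pt : ℝ) = (b - a) * Polynomial.aeval (a + (b - a) * t) P := by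
    intro t
    rw [hPt, map_mul, Polynomial.aeval_C, Polynomial.aeval_comp, hΦev, Polynomial.aeval_map_algebraMap]
    rfl
  have hmem : ∀ t ∈ Set.Icc (0:ℝ) 1, a + (b - a) * t ∈ Set.Icc a b := by
    intro t ht
    constructor <;> nlinarith [ht.1, ht.2, hs]
  have hQt01 : ∀ t ∈ Set.Icc (0:ℝ) 1, (Polynomial.aeval t Qt : ℝ) ≠ 0 := by
    intro t ht
    rw [hQtev]
    exact hQab _ (hmem t ht)
  obtain ⟨T, hTd, hTi⟩ := AlgSplitK5.exists_repK_unit Pt Qt hQt01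
  -- the affine move `x = (b - a) y + a`
  have hmove : of T - of N ∈ relationsLE 1 := by
    refine SiegeK3.affineA_sub_mem_relationsLE (s := b - a) (t := a) hsA ha hs.ne' T N
      (fun y => (Polynomial.aeval y P : ℝ) / Polynomial.aeval y Q) ?_ hNi fun x _ => ?_
    · rw [hTd, image_affine_slab_of_pos hs, hNd, mul_zero, zero_add, mul_one, sub_add_cancel]
    · rw [hTi, abs_of_pos hs]
      simp only
      rw [hPtev, hQtev, show a + (b - a) * x 0 = (b - a) * x 0 + a from add_comm _ _]
      ring
  have hcls : QuotientAddGroup.mk' (relationsLE 1) (of N) = QuotientAddGroup.mk' (relationsLE 1) (of T) := by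
    rw [← QuotientAddGroup.eq_zero_iff] at hmove
    change QuotientAddGroup.mk' (relationsLE 1) _ = 0 at hmove
    rw [map_sub, sub_eq_zero] at hmove
    exact hmove.symm
  rw [hcls]
  exact nfD_of_algK hR hZ hRG Pt Qt hQt01 T hTd (by rw [hTi]; exact fun _ _ => rfl)

/-- **Any bounded interval with algebraic ends** is a mixed normal form in `FormalRep ⧸ relationsLE 1`
(the empty slab, `b ≤ a`, being the zero class) (inside the budget `relationsLE 1`; registered
sub-goal of crux stmt-KontsevichZagierPeriods-12475, port of `PiBox.Dlog.nfD_of_isRational_interval_any`).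
[cite: KontsevichZagier2001, §1.2 rules (1), (2)] -/
theorem nfD_of_isRational_interval_any : ∀ {RA : ℝ → ℝ → ℝ → KZ.IntegralRep 1}
    {ZA : ℝ → KZ.IntegralRep 0} {RG : ℝ → ℝ → KZ.IntegralRep 1},
    (∀ a b c, IsAlgebraic ℚ a → IsAlgebraic ℚ b → IsAlgebraic ℚ c → 0 < a →
      (RA a b c).domain = {x | x 0 ∈ Set.Ioo a b} ∧ (RA a b c).integrand = fun x => c / x 0) →
    (∀ r, IsAlgebraic ℚ r → (ZA r).domain = Set.univ ∧ (ZA r).integrand = fun _ => r) →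
    (∀ t d, IsAlgebraic ℚ t → IsAlgebraic ℚ d →
      (RG t d).domain = {x | x 0 ∈ Set.Ioo 0 t} ∧ (RG t d).integrand = fun x => d / (1 + x 0 ^ 2)) →
    ∀ {a b : ℝ}, IsAlgebraic ℚ a → IsAlgebraic ℚ b →
    ∀ (N : KZ.IntegralRep 1), N.domain = {x | x 0 ∈ Set.Ioo a b} → N.IsRational →
    ∃ (r : ℝ) (k : ℕ) (u c : Fin k → ℝ) (k' : ℕ) (t d : Fin k' → ℝ), IsAlgebraic ℚ r ∧
      (∀ j, 1 < u j) ∧ (∀ j, IsAlgebraic ℚ (u j)) ∧ (∀ j, IsAlgebraic ℚ (c j)) ∧ (∀ l, 0 ≤ t l) ∧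
      (∀ l, IsAlgebraic ℚ (t l)) ∧ (∀ l, IsAlgebraic ℚ (d l)) ∧
      QuotientAddGroup.mk' (KZ.relationsLE 1) (KZ.of N) =
        QuotientAddGroup.mk' (KZ.relationsLE 1) (KZ.of (ZA r)) +
          ∑ j, QuotientAddGroup.mk' (KZ.relationsLE 1) (KZ.of (RA 1 (u j) (c j))) +
          ∑ l, QuotientAddGroup.mk' (KZ.relationsLE 1) (KZ.of (RG (t l) (d l))) := by
  intro RA ZA RG hR hZ hRG a b ha hb N hNd hN
  by_cases hab : a < b
  · exact nfD_of_isRational_interval hR hZ hRG ha hb hab N hNd hN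
  · have h0 : QuotientAddGroup.mk' (relationsLE 1) (of N) = 0 :=
      (QuotientAddGroup.eq_zero_iff _).mpr (slab_empty_mem_relationsLE N hNd (not_lt.mp hab))
    rw [h0]
    exact nfD_zero hZ

end Dlog


end Summit.KontsevichZagierPeriods.AbelContraction.RealHyperellipticSector.Port

end
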